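import Mathlib
import HarnessLib
import Literature.Analysis.Calculus.IteratedDerivLeibnizBound
import Summits.HubbardSuperconductivity.HubbardSuperconductivity.Theorems.KLProgrammeC4aPPKernelTrueJetsCore
import Summits.HubbardSuperconductivity.HubbardSuperconductivity.Theorems.KLProgrammeC4aPPKernelPartition

/-!
# Route `KLProgramme` — crux C4a, S3 brick (B4) «(B4)-UMK1», «(U1)-K-JETS-ALL-ORDERS» part 2: the `u`-jets of the product-form pp kernel AT EVERY ORDER —
# `|∂ᵤᵏ P(e,u)| ≤ (k+1)!·2^{2k+2}·(1+X)·max(Λ,|u|)^{−(k+1)}` for ALL levels `e, u`, uniformly in `β` (no level box, no `e ≠ 0`, no `log`)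

Cell `gate-hubbard-kl`, seat hubbard-kl-k3c3-p1 (g20; row «δμ-flow with klAngularMean constant piece»).  Kernel side of the ORDERS `2…4` of the (C)-closer's
co-moving jets (stub (C) `stub_twoLeg_curvature` of `KLRegimeEngineV17F2`, stmt-HubbardSuperconductivity-20437; k3c3-p3 g38 memo `SWAP-BY-SYMMETRY.md` §6(b):
«`M₂…M₄` need no new caustic ladder — envelope rows `K″…K⁗` + Faà di Bruno + the window cover»).  The rows `K′, K″` were landed one order at a time with
hand-computed constants (`…C4aPPKernelTrueKernelD2`, `…TrueSignedDeriv2`; floor `|e|` on a level box `|e| ≤ K·Λ`); this file proves ONE statement for every `k`,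
on the per-frequency ingredients of part 1 (`…C4aPPKernelTrueJetsCore`) and the one-variable Leibniz bound (`Literature…IteratedDerivLeibnizBound`).
* §1 one summand: `ppKernelSummand_eq_mul_fun`, `shell_of_iteratedDeriv_uvWeightFn_ne_zero`, **`shellTerm_le`** (a Leibniz term with `≥ 1` derivative on the weight:
  zero off the closed shell, `≤ k!·X·2^{2k+2}/(Λ·M^{k+1})·2Λ²/(ωₙ²+Λ²)` on it, `M = max(Λ,|u|)`), **`coreTerm_le`** (the order-zero term:
  `≤ k!·|e|/(ωₙ²+e²)·m₀^{−(k+1)} + (k+1)!·m₀^{−k}·2/(ωₙ²+m₀²)`, `m₀ = max(Λ/2,|u|)`), `abs_iteratedDeriv_ppKernelSummand_le_sum` (Leibniz, order-zero term split off),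
  **`abs_iteratedDeriv_ppKernelSummand_le`** (the COUNT-FREE three-piece dominator) and `abs_iteratedDeriv_ppKernelSummand_le_unif` (a `u`-uniform summable one);
* §2 the kernel: `summable_iteratedDeriv_ppKernelSummand`, **`iteratedDeriv_tsum_ppKernelSummand`** (termwise jets of the FULL series, every `k`, dominated
  differentiation by induction), **`iteratedDeriv_ppTrueKernel_eq_tsum`** (`∂ᵤᵏP = (2/β)Σ'ₙ ∂ᵤᵏsₙ`), and the HEADLINE **`abs_iteratedDeriv_ppTrueKernel_le`**:
  `|∂ᵤᵏ P(e,u)| ≤ (k+1)!·2^{2k+2}·(1+X)·(1/max(Λ,|u|))^{k+1}` for all `e u : ℝ`, `0 < β`, `0 < Λ`, given the cutoff jets `‖χ₂⁽ˡ⁾‖ ≤ X` (`l ≤ k`; discharged for any `k`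
  by `exists_norm_iteratedFDeriv_salmhoferCutoff_le_all` of `…KLRegimeSplitFrameExtFnConst`) — exact `tanh` sums for the two core pieces, the count-free shell
  `(2/β)Σₙ 2Λ²/(ωₙ²+Λ²) ≤ Λ` for the weight-derivative terms; corollaries **`abs_iteratedDeriv_ppTrueKernel_le_of_floor`** (any floor `0 < m ≤ K·Λ`, `1 ≤ K`:
  `≤ C_k·K^{k+1}·max(m,|u|)^{−(k+1)}` — the law-row shape), **`abs_iteratedDeriv_ppTrueKernel_e_le`** (the loop-level jets by `P(e,u) = P(u,e)`), and
  `continuous_iteratedDeriv_ppTrueKernel_u`.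
WHY THE FLOOR IS `Λ` AND NOT `|e|`: for `|u| ≪ Λ ≪ |e|` the true size is `|∂ᵤᵏP| ≍ 1/(|e|Λᵏ)` (the partner leg's above-scale weight floors the partner level at `Λ`;
nothing floors it at `|e|`), so `1/max(|e|,|u|)^{k+1}` is false off a level box — the order-`≤ 2` rows' `K = hi/Λ` dependence is this conversion, not a loss.
At `k = 1, 2` the constants `32(1+X)`, `384(1+X)` replace the hand tables `C_P1`, `C_P2` of `…TrueKernelD2` up to the floor conversion.
Pure real/complex analysis on landed objects; nothing asserts (C), any engine row, K3, the window or superconductivity.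
References: BGM 2006 §2.1 (2.3)–(2.4), §2.2 (2.36aa), §2.4 (2.36) [cite: BenfattoGiulianiMastropietro2006]; Salmhofer 1999 §4.2.4 (4.63), §4.2.5 (4.70)–(4.71) [cite: Salmhofer1999].
-/

noncomputable section

namespace Summit.HubbardSuperconductivity.HubbardSuperconductivity.Theorems.C4a

set_option linter.dupNamespace false -- summit = problem name (single-conjunct summit), D-0017

open Real Filter Set Finset Complex
open scoped Topology Nat
open Literature.MathematicalPhysics.QuantumLattice Literature.Analysis.SpecialFunctions Literature.Analysis.Calculus

/-! ## §1 One summand `sₙ(e,·) = W(ωₙ,e)·W(ωₙ,·)·c_ωₙ(e,·)`: the count-free dominator and the `u`-uniform summable one -/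

/-- The summand as a product (loop weight × partner weight) × core. [folklore] -/
theorem ppKernelSummand_eq_mul_fun (β Λ e : ℝ) (n : ℕ) :
    (fun v : ℝ => ppKernelSummand β Λ e v n) = fun v : ℝ =>
      (fun v : ℝ => uvWeightFn Λ (ppFreq β n) e * uvWeightFn Λ (ppFreq β n) v) v *
        (fun v : ℝ => (e * v + ppFreq β n ^ 2) / ((ppFreq β n ^ 2 + e ^ 2) * (ppFreq β n ^ 2 + v ^ 2))) v := by
  funext v; rfl

/-- Shell activity of a weight jet of order `≥ 1`: if `∂ᵤʲW(ω,·)(u) ≠ 0` then `Λ²/4 ≤ u²+ω² ≤ Λ²`. [cite: Salmhofer1999, §4.2.5 (4.71)] -/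
theorem shell_of_iteratedDeriv_uvWeightFn_ne_zero {Λ : ℝ} (hΛ : 0 < Λ) {ω u : ℝ} {j : ℕ} (hj : 1 ≤ j)
    (h : iteratedDeriv j (fun v : ℝ => uvWeightFn Λ ω v) u ≠ 0) : Λ ^ 2 / 4 ≤ u ^ 2 + ω ^ 2 ∧ u ^ 2 + ω ^ 2 ≤ Λ ^ 2 := by
  by_contra hc
  rw [not_and_or, not_le, not_le] at hc
  rcases hc with hlt | hgt
  · exact h (iteratedDeriv_uvWeightFn_eq_zero_of_lt hΛ hlt j)
  · exact h (iteratedDeriv_uvWeightFn_eq_zero_of_gt hΛ hgt hj)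

/-- **One shell term** (`i+1 ≤ k`): `C(k,i+1)·|W(ωₙ,e)|·|∂ᵤ^{i+1}W(ωₙ,·)(u)|·|∂ᵤ^{k−1−i}c(u)| ≤ k!·X·2^{2k+2}/(Λ·max(Λ,|u|)^{k+1})·2Λ²/(ωₙ²+Λ²)`
(zero off the closed shell; on it `‖iω+u‖ ≥ Λ/2`, `ωₙ ≤ Λ`, `|u| ≤ Λ`, `|W_e|·‖(−iω+e)⁻¹‖ ≤ 2/Λ`). [cite: BenfattoGiulianiMastropietro2006, §2.2 (2.36aa)] -/
theorem shellTerm_le {β Λ : ℝ} (hβ : 0 < β) (hΛ : 0 < Λ) {k : ℕ} {X : ℝ}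
    (hX : ∀ l ≤ k, ∀ x : ℝ, ‖iteratedFDeriv ℝ l salmhoferCutoff x‖ ≤ X) (e u : ℝ) (n : ℕ) {i : ℕ} (hi : i < k) :
    (k.choose (i + 1) : ℝ) * ‖iteratedDeriv (i + 1) (fun v : ℝ => uvWeightFn Λ (ppFreq β n) e * uvWeightFn Λ (ppFreq β n) v) u‖ *
        ‖iteratedDeriv (k - (i + 1)) (fun v : ℝ => (e * v + ppFreq β n ^ 2) / ((ppFreq β n ^ 2 + e ^ 2) * (ppFreq β n ^ 2 + v ^ 2))) u‖ ≤
      k ! * X * 2 ^ (2 * k + 2) / (Λ * max Λ |u| ^ (k + 1)) * (2 * Λ ^ 2 / (ppFreq β n ^ 2 + Λ ^ 2)) := by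
  have hω := ppFreq_pos hβ n
  have hX0 : 0 ≤ X := zero_le_one.trans (one_le_of_cutoff_jets hX)
  set ω := ppFreq β n with hω_def
  by_cases hz : iteratedDeriv (i + 1) (fun v : ℝ => uvWeightFn Λ ω v) u = 0
  · rw [iteratedDeriv_const_mul_field, hz, mul_zero, norm_zero, mul_zero, zero_mul]; positivity
  · -- on the closed shell
    obtain ⟨hlo, hhi⟩ := shell_of_iteratedDeriv_uvWeightFn_ne_zero hΛ (Nat.le_add_left 1 i) hz
    have huΛ : |u| ≤ Λ := by
      have : u ^ 2 ≤ Λ ^ 2 := by nlinarith [sq_nonneg ω]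
      exact abs_le_of_sq_le_sq this hΛ.le
    have hM : max Λ |u| = Λ := max_eq_left huΛ
    have hωΛ : ω ≤ Λ := by
      have : ω ^ 2 ≤ Λ ^ 2 := by nlinarith [sq_nonneg u]
      exact (abs_le_of_sq_le_sq' this hΛ.le).2
    have hmaj : 1 ≤ 2 * Λ ^ 2 / (ω ^ 2 + Λ ^ 2) := by
      rw [le_div_iff₀ (by positivity)]; nlinarith
    have hw : Λ / 2 ≤ ‖I * ω + (u : ℂ)‖ := by
      by_contra hlt
      push Not at hlt
      have h0 : 0 ≤ ‖I * ω + (u : ℂ)‖ := norm_nonneg _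
      have h2 : ‖I * ω + (u : ℂ)‖ ^ 2 < (Λ / 2) ^ 2 := by gcongr
      rw [norm_I_mul_add_sq] at h2
      linarith
    have hw0 : 0 < ‖I * ω + (u : ℂ)‖ := lt_of_lt_of_le (by positivity) hw
    have hw' : 1 / ‖I * ω + (u : ℂ)‖ ≤ 2 / Λ := by
      rw [div_le_div_iff₀ hw0 hΛ]; linarith
    -- the three factors
    have hW : ‖iteratedDeriv (i + 1) (fun v : ℝ => uvWeightFn Λ ω e * uvWeightFn Λ ω v) u‖ ≤
        |uvWeightFn Λ ω e| * ((i + 1)! * X * (4 / Λ) ^ (i + 1)) := by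
      rw [iteratedDeriv_const_mul_field, norm_mul, Real.norm_eq_abs, Real.norm_eq_abs]
      exact mul_le_mul_of_nonneg_left (abs_iteratedDeriv_uvWeightFn_le hΛ ω (fun l hl x => hX l (by omega) x) u) (abs_nonneg _)
    have hC : ‖iteratedDeriv (k - (i + 1)) (fun v : ℝ => (e * v + ω ^ 2) / ((ω ^ 2 + e ^ 2) * (ω ^ 2 + v ^ 2))) u‖ ≤
        (k - (i + 1))! * ‖(-I * ω + (e : ℂ))⁻¹‖ * (2 / Λ) ^ (k - (i + 1) + 1) := by
      rw [Real.norm_eq_abs]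
      refine (abs_iteratedDeriv_pairCore_le_crude hω e _ u).trans ?_
      gcongr
    have hWa : |uvWeightFn Λ ω e| * ‖(-I * ω + (e : ℂ))⁻¹‖ ≤ 2 / Λ := abs_uvWeightFn_mul_norm_inv_le hΛ ω e
    -- combinatorics: `C(k,i+1)(i+1)!(k-1-i)! = k!`
    have hchoose : (k.choose (i + 1) : ℝ) * ((i + 1)! : ℝ) * ((k - (i + 1))! : ℝ) = k ! := by
      have := Nat.choose_mul_factorial_mul_factorial (show i + 1 ≤ k by omega)
      exact_mod_cast this
    -- powers: `(4/Λ)^{i+1} (2/Λ)^{k-i} (2/Λ) ≤ 2^{2k+2}/Λ^{k+2}`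
    have hpow : (4 / Λ) ^ (i + 1) * (2 / Λ) ^ (k - (i + 1) + 1) * (2 / Λ) = 2 ^ (k + i + 3) / Λ ^ (k + 2) := by
      have h4 : (4 : ℝ) = 2 ^ 2 := by norm_num
      rw [h4, div_pow, div_pow, ← pow_mul, div_mul_div_comm, div_mul_div_comm, ← pow_add, ← pow_succ, ← pow_add, ← pow_succ]
      congr 1 <;> congr 1 <;> omega
    have hpow' : (2 : ℝ) ^ (k + i + 3) ≤ 2 ^ (2 * k + 2) := pow_le_pow_right₀ (by norm_num) (by omega)
    calc (k.choose (i + 1) : ℝ) * ‖iteratedDeriv (i + 1) (fun v : ℝ => uvWeightFn Λ ω e * uvWeightFn Λ ω v) u‖ *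
          ‖iteratedDeriv (k - (i + 1)) (fun v : ℝ => (e * v + ω ^ 2) / ((ω ^ 2 + e ^ 2) * (ω ^ 2 + v ^ 2))) u‖
        ≤ (k.choose (i + 1) : ℝ) * (|uvWeightFn Λ ω e| * ((i + 1)! * X * (4 / Λ) ^ (i + 1))) *
            ((k - (i + 1))! * ‖(-I * ω + (e : ℂ))⁻¹‖ * (2 / Λ) ^ (k - (i + 1) + 1)) := by gcongr
      _ = ((k.choose (i + 1) : ℝ) * ((i + 1)! : ℝ) * ((k - (i + 1))! : ℝ)) * X *
            ((|uvWeightFn Λ ω e| * ‖(-I * ω + (e : ℂ))⁻¹‖) * ((4 / Λ) ^ (i + 1) * (2 / Λ) ^ (k - (i + 1) + 1))) := by ring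
      _ ≤ (k ! : ℝ) * X * ((2 / Λ) * ((4 / Λ) ^ (i + 1) * (2 / Λ) ^ (k - (i + 1) + 1))) := by rw [hchoose]; gcongr
      _ = (k ! : ℝ) * X * (2 ^ (k + i + 3) / Λ ^ (k + 2)) := by rw [← hpow]; ring
      _ ≤ (k ! : ℝ) * X * (2 ^ (2 * k + 2) / Λ ^ (k + 2)) * (2 * Λ ^ 2 / (ω ^ 2 + Λ ^ 2)) := by
          rw [← mul_one ((k ! : ℝ) * X * (2 ^ (k + i + 3) / Λ ^ (k + 2)))]
          gcongr
      _ = k ! * X * 2 ^ (2 * k + 2) / (Λ * max Λ |u| ^ (k + 1)) * (2 * Λ ^ 2 / (ω ^ 2 + Λ ^ 2)) := by rw [hM]; ring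

/-- **The order-zero Leibniz term**: `|W(ωₙ,e)W(ωₙ,u)|·|∂ᵤᵏc(u)| ≤ k!·|e|/(ωₙ²+e²)·m₀^{−(k+1)} + (k+1)!·m₀^{−k}·2/(ωₙ²+m₀²)` (`m₀ = max(Λ/2,|u|)`).
[cite: BenfattoGiulianiMastropietro2006, §2.1 (2.3)-(2.4)] -/
theorem coreTerm_le {β Λ : ℝ} (hβ : 0 < β) (hΛ : 0 < Λ) (e u : ℝ) (n k : ℕ) :
    ‖iteratedDeriv 0 (fun v : ℝ => uvWeightFn Λ (ppFreq β n) e * uvWeightFn Λ (ppFreq β n) v) u‖ *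
        ‖iteratedDeriv k (fun v : ℝ => (e * v + ppFreq β n ^ 2) / ((ppFreq β n ^ 2 + e ^ 2) * (ppFreq β n ^ 2 + v ^ 2))) u‖ ≤
      k ! * (|e| / (ppFreq β n ^ 2 + e ^ 2)) * (1 / max (Λ / 2) |u|) ^ (k + 1) +
        (k + 1)! * ((1 / max (Λ / 2) |u|) ^ k * (2 / (ppFreq β n ^ 2 + max (Λ / 2) |u| ^ 2))) := by
  have hω := ppFreq_pos hβ n
  set ω := ppFreq β n with hω_def
  rw [iteratedDeriv_zero, norm_mul, Real.norm_eq_abs, Real.norm_eq_abs, Real.norm_eq_abs]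
  have hWe : |uvWeightFn Λ ω e| ≤ 1 := abs_uvWeightFn_le_one _ _ _
  have hcore := abs_iteratedDeriv_pairCore_le hω e k u
  have h1 := abs_uvWeightFn_mul_inv_norm_pow_le hΛ ω u (k + 1)
  have h2 := abs_uvWeightFn_mul_inv_norm_pow_add_two_le hΛ ω u k
  have hWu0 : 0 ≤ |uvWeightFn Λ ω u| := abs_nonneg _
  calc |uvWeightFn Λ ω e| * |uvWeightFn Λ ω u| *
        |iteratedDeriv k (fun v : ℝ => (e * v + ω ^ 2) / ((ω ^ 2 + e ^ 2) * (ω ^ 2 + v ^ 2))) u|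
      ≤ 1 * |uvWeightFn Λ ω u| * (k ! * (|e| / (ω ^ 2 + e ^ 2)) * (1 / ‖I * ω + (u : ℂ)‖) ^ (k + 1) +
          (k + 1)! * (1 / ‖I * ω + (u : ℂ)‖) ^ (k + 2)) := by gcongr
    _ = k ! * (|e| / (ω ^ 2 + e ^ 2)) * (|uvWeightFn Λ ω u| * (1 / ‖I * ω + (u : ℂ)‖) ^ (k + 1)) +
          (k + 1)! * (|uvWeightFn Λ ω u| * (1 / ‖I * ω + (u : ℂ)‖) ^ (k + 2)) := by ring
    _ ≤ k ! * (|e| / (ω ^ 2 + e ^ 2)) * (1 / max (Λ / 2) |u|) ^ (k + 1) +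
          (k + 1)! * ((1 / max (Λ / 2) |u|) ^ k * (2 / (ω ^ 2 + max (Λ / 2) |u| ^ 2))) := by gcongr

/-- **Leibniz for one summand**, order-zero term split off:
`|∂ᵤᵏsₙ(u)| ≤ ‖f‖·‖∂ᵏc‖ + Σ_{i<k} C(k,i+1)·‖∂^{i+1}f‖·‖∂^{k−1−i}c‖` with `f = W(ωₙ,e)·W(ωₙ,·)`, `c` the core. [folklore] -/
theorem abs_iteratedDeriv_ppKernelSummand_le_sum {β : ℝ} (hβ : 0 < β) (Λ e u : ℝ) (n k : ℕ) :
    |iteratedDeriv k (fun v : ℝ => ppKernelSummand β Λ e v n) u| ≤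
      ‖iteratedDeriv 0 (fun v : ℝ => uvWeightFn Λ (ppFreq β n) e * uvWeightFn Λ (ppFreq β n) v) u‖ *
          ‖iteratedDeriv k (fun v : ℝ => (e * v + ppFreq β n ^ 2) / ((ppFreq β n ^ 2 + e ^ 2) * (ppFreq β n ^ 2 + v ^ 2))) u‖ +
        ∑ i ∈ Finset.range k, (k.choose (i + 1) : ℝ) *
          ‖iteratedDeriv (i + 1) (fun v : ℝ => uvWeightFn Λ (ppFreq β n) e * uvWeightFn Λ (ppFreq β n) v) u‖ *
          ‖iteratedDeriv (k - (i + 1)) (fun v : ℝ => (e * v + ppFreq β n ^ 2) / ((ppFreq β n ^ 2 + e ^ 2) * (ppFreq β n ^ 2 + v ^ 2))) u‖ := by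
  have hω := ppFreq_pos hβ n
  have hf : ContDiff ℝ k (fun v : ℝ => uvWeightFn Λ (ppFreq β n) e * uvWeightFn Λ (ppFreq β n) v) :=
    contDiff_const.mul (contDiff_uvWeightFn_band Λ (ppFreq β n))
  have hg : ContDiff ℝ k (fun v : ℝ => (e * v + ppFreq β n ^ 2) / ((ppFreq β n ^ 2 + e ^ 2) * (ppFreq β n ^ 2 + v ^ 2))) :=
    contDiff_pairCore hω.ne' e
  have hL := norm_iteratedDeriv_mul_le hf hg u
  rw [ppKernelSummand_eq_mul_fun, ← Real.norm_eq_abs]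
  refine hL.trans (le_of_eq ?_)
  rw [Finset.sum_range_succ', Nat.choose_zero_right, Nat.cast_one, one_mul, Nat.sub_zero, add_comm]

/-- **The count-free dominator of one summand's `k`-th jet** (`m₀ = max(Λ/2,|u|)`, `M = max(Λ,|u|)`):
`|∂ᵤᵏsₙ(e,u)| ≤ k!·|e|/(ωₙ²+e²)·m₀^{−(k+1)} + (k+1)!·m₀^{−k}·2/(ωₙ²+m₀²) + k·k!·X·2^{2k+2}/(Λ·M^{k+1})·2Λ²/(ωₙ²+Λ²)`.
[cite: BenfattoGiulianiMastropietro2006, §2.1 (2.3)-(2.4)] -/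
theorem abs_iteratedDeriv_ppKernelSummand_le {β Λ : ℝ} (hβ : 0 < β) (hΛ : 0 < Λ) {k : ℕ} {X : ℝ}
    (hX : ∀ l ≤ k, ∀ x : ℝ, ‖iteratedFDeriv ℝ l salmhoferCutoff x‖ ≤ X) (e u : ℝ) (n : ℕ) :
    |iteratedDeriv k (fun v : ℝ => ppKernelSummand β Λ e v n) u| ≤
      k ! * (|e| / (ppFreq β n ^ 2 + e ^ 2)) * (1 / max (Λ / 2) |u|) ^ (k + 1) +
        (k + 1)! * ((1 / max (Λ / 2) |u|) ^ k * (2 / (ppFreq β n ^ 2 + max (Λ / 2) |u| ^ 2))) +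
        k * (k ! * X * 2 ^ (2 * k + 2) / (Λ * max Λ |u| ^ (k + 1)) * (2 * Λ ^ 2 / (ppFreq β n ^ 2 + Λ ^ 2))) := by
  refine (abs_iteratedDeriv_ppKernelSummand_le_sum hβ Λ e u n k).trans ?_
  have h0 := coreTerm_le hβ hΛ e u n k
  have hS : ∑ i ∈ Finset.range k, (k.choose (i + 1) : ℝ) *
        ‖iteratedDeriv (i + 1) (fun v : ℝ => uvWeightFn Λ (ppFreq β n) e * uvWeightFn Λ (ppFreq β n) v) u‖ *
        ‖iteratedDeriv (k - (i + 1)) (fun v : ℝ => (e * v + ppFreq β n ^ 2) / ((ppFreq β n ^ 2 + e ^ 2) * (ppFreq β n ^ 2 + v ^ 2))) u‖ ≤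
      ∑ _i ∈ Finset.range k, k ! * X * 2 ^ (2 * k + 2) / (Λ * max Λ |u| ^ (k + 1)) * (2 * Λ ^ 2 / (ppFreq β n ^ 2 + Λ ^ 2)) :=
    Finset.sum_le_sum fun i hi => shellTerm_le hβ hΛ hX e u n (Finset.mem_range.1 hi)
  rw [Finset.sum_const, Finset.card_range, nsmul_eq_mul] at hS
  linarith

/-- **The `u`-uniform summable dominator** (for termwise differentiation; `β`, `Λ`, `e`, `k` may enter, `u` may not):
`∃ C, ∀ n u, |∂ᵤᵏsₙ(e,u)| ≤ C·1/ωₙ²` — the count-free dominator with `m₀ ≥ Λ/2`, `M ≥ Λ` and `ωₙ² + a² ≥ ωₙ²`. [folklore] -/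
theorem abs_iteratedDeriv_ppKernelSummand_le_unif {β Λ : ℝ} (hβ : 0 < β) (hΛ : 0 < Λ) {k : ℕ} {X : ℝ}
    (hX : ∀ l ≤ k, ∀ x : ℝ, ‖iteratedFDeriv ℝ l salmhoferCutoff x‖ ≤ X) (e : ℝ) :
    ∃ C : ℝ, ∀ (n : ℕ) (u : ℝ), |iteratedDeriv k (fun v : ℝ => ppKernelSummand β Λ e v n) u| ≤ C * (1 / (ppFreq β n ^ 2 + 0 ^ 2)) := by
  have hX0 : 0 ≤ X := zero_le_one.trans (one_le_of_cutoff_jets hX)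
  refine ⟨k ! * |e| * (2 / Λ) ^ (k + 1) + (k + 1)! * ((2 / Λ) ^ k * 2) + k * (k ! * X * 2 ^ (2 * k + 2) / (Λ * Λ ^ (k + 1)) * (2 * Λ ^ 2)),
    fun n u => ?_⟩
  have hω := ppFreq_pos hβ n
  set ω := ppFreq β n with hω_def
  have hm₀ : Λ / 2 ≤ max (Λ / 2) |u| := le_max_left _ _
  have hM : Λ ≤ max Λ |u| := le_max_left _ _
  have hm0 : 0 < max (Λ / 2) |u| := lt_of_lt_of_le (by positivity) hm₀
  have hinv : 1 / max (Λ / 2) |u| ≤ 2 / Λ := by rw [div_le_div_iff₀ hm0 hΛ]; linarith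
  have hq : 1 / (ω ^ 2 + 0 ^ 2) = 1 / ω ^ 2 := by rw [zero_pow two_ne_zero, add_zero]
  have he : |e| / (ω ^ 2 + e ^ 2) ≤ |e| * (1 / (ω ^ 2 + 0 ^ 2)) := by
    rw [hq, mul_one_div]; exact div_le_div_of_nonneg_left (abs_nonneg e) (by positivity) (by nlinarith [sq_nonneg e])
  have h2 : 2 / (ω ^ 2 + max (Λ / 2) |u| ^ 2) ≤ 2 * (1 / (ω ^ 2 + 0 ^ 2)) := by
    rw [hq, mul_one_div]; exact div_le_div_of_nonneg_left zero_le_two (by positivity) (by nlinarith [sq_nonneg (max (Λ / 2) |u|)])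
  have h3 : 2 * Λ ^ 2 / (ω ^ 2 + Λ ^ 2) ≤ 2 * Λ ^ 2 * (1 / (ω ^ 2 + 0 ^ 2)) := by
    rw [hq, mul_one_div]; exact div_le_div_of_nonneg_left (by positivity) (by positivity) (by nlinarith [sq_nonneg Λ])
  refine (abs_iteratedDeriv_ppKernelSummand_le hβ hΛ hX e u n).trans ?_
  have hq0 : 0 ≤ 1 / (ω ^ 2 + 0 ^ 2) := by positivity
  calc (k ! : ℝ) * (|e| / (ω ^ 2 + e ^ 2)) * (1 / max (Λ / 2) |u|) ^ (k + 1) +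
        (k + 1)! * ((1 / max (Λ / 2) |u|) ^ k * (2 / (ω ^ 2 + max (Λ / 2) |u| ^ 2))) +
        k * (k ! * X * 2 ^ (2 * k + 2) / (Λ * max Λ |u| ^ (k + 1)) * (2 * Λ ^ 2 / (ω ^ 2 + Λ ^ 2)))
      ≤ (k ! : ℝ) * (|e| * (1 / (ω ^ 2 + 0 ^ 2))) * (2 / Λ) ^ (k + 1) +
        (k + 1)! * ((2 / Λ) ^ k * (2 * (1 / (ω ^ 2 + 0 ^ 2)))) +
        k * (k ! * X * 2 ^ (2 * k + 2) / (Λ * Λ ^ (k + 1)) * (2 * Λ ^ 2 * (1 / (ω ^ 2 + 0 ^ 2)))) := by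
        gcongr
    _ = (k ! * |e| * (2 / Λ) ^ (k + 1) + (k + 1)! * ((2 / Λ) ^ k * 2) + k * (k ! * X * 2 ^ (2 * k + 2) / (Λ * Λ ^ (k + 1)) * (2 * Λ ^ 2))) *
        (1 / (ω ^ 2 + 0 ^ 2)) := by ring

/-! ## §2 The kernel: termwise jets of the full series and the all-orders envelope -/

/-- The `k`-th jets of the summands are summable over the frequencies (at fixed levels). [cite: BenfattoGiulianiMastropietro2006, §2.1 (2.3)-(2.4)] -/
theorem summable_iteratedDeriv_ppKernelSummand {β Λ : ℝ} (hβ : 0 < β) (hΛ : 0 < Λ) {k : ℕ} {X : ℝ}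
    (hX : ∀ l ≤ k, ∀ x : ℝ, ‖iteratedFDeriv ℝ l salmhoferCutoff x‖ ≤ X) (e u : ℝ) :
    Summable fun n : ℕ => iteratedDeriv k (fun v : ℝ => ppKernelSummand β Λ e v n) u := by
  obtain ⟨C, hC⟩ := abs_iteratedDeriv_ppKernelSummand_le_unif hβ hΛ hX e
  exact Summable.of_norm_bounded ((summable_one_div_ppFreq_sq_add_sq hβ 0).mul_left C) fun n => by
    rw [Real.norm_eq_abs]; exact hC n u

/-- **TERMWISE JETS OF THE FULL SERIES**: `∂ᵤᵏ Σₙ sₙ(e,·) = Σₙ ∂ᵤᵏsₙ(e,·)` for every `k` (dominated differentiation, induction on `k`).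
[cite: BenfattoGiulianiMastropietro2006, §2.1 (2.3)-(2.4)] -/
theorem iteratedDeriv_tsum_ppKernelSummand {β Λ : ℝ} (hβ : 0 < β) (hΛ : 0 < Λ) {k : ℕ} {X : ℝ}
    (hX : ∀ l ≤ k, ∀ x : ℝ, ‖iteratedFDeriv ℝ l salmhoferCutoff x‖ ≤ X) (e : ℝ) :
    iteratedDeriv k (fun v : ℝ => ∑' n : ℕ, ppKernelSummand β Λ e v n) =
      fun u => ∑' n : ℕ, iteratedDeriv k (fun v : ℝ => ppKernelSummand β Λ e v n) u := by
  induction k with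
  | zero => funext u; simp
  | succ k ih =>
    have hXk : ∀ l ≤ k, ∀ x : ℝ, ‖iteratedFDeriv ℝ l salmhoferCutoff x‖ ≤ X := fun l hl x => hX l (Nat.le_succ_of_le hl) x
    rw [iteratedDeriv_succ, ih hXk]
    funext u
    obtain ⟨C₁, hC₁⟩ := abs_iteratedDeriv_ppKernelSummand_le_unif hβ hΛ hX e
    have hdiff : ∀ n, Differentiable ℝ (iteratedDeriv k (fun v : ℝ => ppKernelSummand β Λ e v n)) := fun n =>
      (contDiff_ppKernelSummand_u hβ Λ e n (N := ((k + 1 : ℕ) : ℕ∞))).differentiable_iteratedDeriv' k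
    have hbd : ∀ n y, ‖deriv (iteratedDeriv k (fun v : ℝ => ppKernelSummand β Λ e v n)) y‖ ≤ C₁ * (1 / (ppFreq β n ^ 2 + 0 ^ 2)) :=
      fun n y => by rw [← iteratedDeriv_succ, Real.norm_eq_abs]; exact hC₁ n y
    have hsum : Summable fun n => C₁ * (1 / (ppFreq β n ^ 2 + 0 ^ 2)) := (summable_one_div_ppFreq_sq_add_sq hβ 0).mul_left _
    rw [deriv_tsum_apply hsum hdiff hbd (summable_iteratedDeriv_ppKernelSummand hβ hΛ hXk e u) u]
    exact tsum_congr fun n => by rw [iteratedDeriv_succ]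

/-- **`∂ᵤᵏ P(e,u) = (2/β)·Σₙ ∂ᵤᵏ sₙ(e,u)`** for every `k` and all levels. [cite: BenfattoGiulianiMastropietro2006, §2.1 (2.3)-(2.4)] -/
theorem iteratedDeriv_ppTrueKernel_eq_tsum {β Λ : ℝ} (hβ : 0 < β) (hΛ : 0 < Λ) {k : ℕ} {X : ℝ}
    (hX : ∀ l ≤ k, ∀ x : ℝ, ‖iteratedFDeriv ℝ l salmhoferCutoff x‖ ≤ X) (e u : ℝ) :
    iteratedDeriv k (fun v : ℝ => ppTrueKernel β Λ e v) u = 2 / β * ∑' n : ℕ, iteratedDeriv k (fun v : ℝ => ppKernelSummand β Λ e v n) u := by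
  have hfun : (fun v : ℝ => ppTrueKernel β Λ e v) = fun v : ℝ => 2 / β * ∑' n : ℕ, ppKernelSummand β Λ e v n := rfl
  rw [hfun, iteratedDeriv_const_mul_field, iteratedDeriv_tsum_ppKernelSummand hβ hΛ hX e]

/-- **HEADLINE — the `u`-jets of the pp kernel at every order**: for `0 < β`, `0 < Λ`, cutoff jets `‖χ₂⁽ˡ⁾‖ ≤ X` (`l ≤ k`) and ALL levels `e, u`,
`|∂ᵤᵏ P(e,u)| ≤ (k+1)!·2^{2k+2}·(1+X)·max(Λ,|u|)^{−(k+1)}` — uniformly in `β`, no level box, no `e ≠ 0`, no `log`.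
[cite: BenfattoGiulianiMastropietro2006, §2.4 (2.36)] -/
theorem abs_iteratedDeriv_ppTrueKernel_le {β Λ : ℝ} (hβ : 0 < β) (hΛ : 0 < Λ) {k : ℕ} {X : ℝ}
    (hX : ∀ l ≤ k, ∀ x : ℝ, ‖iteratedFDeriv ℝ l salmhoferCutoff x‖ ≤ X) (e u : ℝ) :
    |iteratedDeriv k (fun v : ℝ => ppTrueKernel β Λ e v) u| ≤ (k + 1)! * 2 ^ (2 * k + 2) * (1 + X) * (1 / max Λ |u|) ^ (k + 1) := by
  have hX0 : 0 ≤ X := zero_le_one.trans (one_le_of_cutoff_jets hX)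
  set m₀ : ℝ := max (Λ / 2) |u| with hm₀_def
  set M : ℝ := max Λ |u| with hM_def
  have hm₀ : 0 < m₀ := lt_max_of_lt_left (by positivity)
  have hM : 0 < M := lt_max_of_lt_left hΛ
  have hmM : 1 / m₀ ≤ 2 * (1 / M) := by
    rw [mul_one_div, div_le_div_iff₀ hm₀ hM, one_mul]
    exact max_le (by linarith [le_max_left (Λ / 2) |u|]) (by linarith [le_max_right (Λ / 2) |u|, abs_nonneg u])
  -- the three summable pieces of the dominator
  set T₁ : ℕ → ℝ := fun n => k ! * (|e| / (ppFreq β n ^ 2 + e ^ 2)) * (1 / m₀) ^ (k + 1) with hT₁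
  set T₂ : ℕ → ℝ := fun n => (k + 1)! * ((1 / m₀) ^ k * (2 / (ppFreq β n ^ 2 + m₀ ^ 2))) with hT₂
  set T₃ : ℕ → ℝ := fun n => k * (k ! * X * 2 ^ (2 * k + 2) / (Λ * M ^ (k + 1)) * (2 * Λ ^ 2 / (ppFreq β n ^ 2 + Λ ^ 2))) with hT₃
  have hS₁ : Summable T₁ := by
    have : T₁ = fun n => (k ! * (1 / m₀) ^ (k + 1) * |e|) * (1 / (ppFreq β n ^ 2 + e ^ 2)) := by funext n; simp only [hT₁]; ring
    rw [this]; exact (summable_one_div_ppFreq_sq_add_sq hβ e).mul_left _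
  have hS₂ : Summable T₂ := by
    have : T₂ = fun n => ((k + 1)! * (1 / m₀) ^ k * 2) * (1 / (ppFreq β n ^ 2 + m₀ ^ 2)) := by funext n; simp only [hT₂]; ring
    rw [this]; exact (summable_one_div_ppFreq_sq_add_sq hβ m₀).mul_left _
  have hS₃ : Summable T₃ := by
    have : T₃ = fun n => (k * (k ! * X * 2 ^ (2 * k + 2) / (Λ * M ^ (k + 1))) * (2 * Λ ^ 2)) * (1 / (ppFreq β n ^ 2 + Λ ^ 2)) := by
      funext n; simp only [hT₃]; ring
    rw [this]; exact (summable_one_div_ppFreq_sq_add_sq hβ Λ).mul_left _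
  have hbound : ∀ n, ‖iteratedDeriv k (fun v : ℝ => ppKernelSummand β Λ e v n) u‖ ≤ T₁ n + T₂ n + T₃ n := fun n => by
    rw [Real.norm_eq_abs]; exact abs_iteratedDeriv_ppKernelSummand_le hβ hΛ hX e u n
  have htsum : ‖∑' n : ℕ, iteratedDeriv k (fun v : ℝ => ppKernelSummand β Λ e v n) u‖ ≤ ∑' n, (T₁ n + T₂ n + T₃ n) :=
    tsum_of_norm_bounded ((hS₁.add hS₂).add hS₃).hasSum hbound
  rw [(hS₁.add hS₂).tsum_add hS₃, hS₁.tsum_add hS₂] at htsum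
  -- the three exact sums
  have h1 : 2 / β * ∑' n, T₁ n ≤ k ! * (1 / m₀) ^ (k + 1) * (1 / 2) := by
    have : ∑' n, T₁ n = k ! * (1 / m₀) ^ (k + 1) * ∑' n, |e| / (ppFreq β n ^ 2 + e ^ 2) := by
      rw [← tsum_mul_left]; exact tsum_congr fun n => by simp only [hT₁]; ring
    rw [this, show 2 / β * (k ! * (1 / m₀) ^ (k + 1) * ∑' n, |e| / (ppFreq β n ^ 2 + e ^ 2)) =
      k ! * (1 / m₀) ^ (k + 1) * (2 / β * ∑' n, |e| / (ppFreq β n ^ 2 + e ^ 2)) by ring]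
    exact mul_le_mul_of_nonneg_left (two_div_mul_tsum_abs_div_le hβ e) (by positivity)
  have h2 : 2 / β * ∑' n, T₂ n ≤ (k + 1)! * (1 / m₀) ^ k * 2 * (1 / (2 * m₀)) := by
    have : ∑' n, T₂ n = (k + 1)! * (1 / m₀) ^ k * 2 * ∑' n, 1 / (ppFreq β n ^ 2 + m₀ ^ 2) := by
      rw [← tsum_mul_left]; exact tsum_congr fun n => by simp only [hT₂]; ring
    rw [this, show 2 / β * ((k + 1)! * (1 / m₀) ^ k * 2 * ∑' n, 1 / (ppFreq β n ^ 2 + m₀ ^ 2)) =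
      (k + 1)! * (1 / m₀) ^ k * 2 * (2 / β * ∑' n, 1 / (ppFreq β n ^ 2 + m₀ ^ 2)) by ring]
    exact mul_le_mul_of_nonneg_left (two_div_mul_tsum_one_div_le hβ hm₀) (by positivity)
  have h3 : 2 / β * ∑' n, T₃ n ≤ k * (k ! * X * 2 ^ (2 * k + 2) / (Λ * M ^ (k + 1))) * Λ := by
    have : ∑' n, T₃ n = k * (k ! * X * 2 ^ (2 * k + 2) / (Λ * M ^ (k + 1))) * ∑' n, 2 * Λ ^ 2 / (ppFreq β n ^ 2 + Λ ^ 2) := by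
      rw [← tsum_mul_left]; exact tsum_congr fun n => by simp only [hT₃]; ring
    rw [this, show 2 / β * (k * (k ! * X * 2 ^ (2 * k + 2) / (Λ * M ^ (k + 1))) * ∑' n, 2 * Λ ^ 2 / (ppFreq β n ^ 2 + Λ ^ 2)) =
      k * (k ! * X * 2 ^ (2 * k + 2) / (Λ * M ^ (k + 1))) * (2 / β * ∑' n, 2 * Λ ^ 2 / (ppFreq β n ^ 2 + Λ ^ 2)) by ring]
    exact mul_le_mul_of_nonneg_left (two_div_mul_tsum_shell_le hβ hΛ) (by positivity)
  -- assemble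
  have hβ2 : 0 < 2 / β := by positivity
  rw [iteratedDeriv_ppTrueKernel_eq_tsum hβ hΛ hX e u, abs_mul, abs_of_pos hβ2]
  have hmain : 2 / β * |∑' n : ℕ, iteratedDeriv k (fun v : ℝ => ppKernelSummand β Λ e v n) u| ≤
      k ! * (1 / m₀) ^ (k + 1) * (1 / 2) + (k + 1)! * (1 / m₀) ^ k * 2 * (1 / (2 * m₀)) + k * (k ! * X * 2 ^ (2 * k + 2) / (Λ * M ^ (k + 1))) * Λ := by
    rw [← Real.norm_eq_abs]
    calc 2 / β * ‖∑' n : ℕ, iteratedDeriv k (fun v : ℝ => ppKernelSummand β Λ e v n) u‖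
        ≤ 2 / β * (∑' n, T₁ n + ∑' n, T₂ n + ∑' n, T₃ n) := mul_le_mul_of_nonneg_left htsum hβ2.le
      _ = 2 / β * ∑' n, T₁ n + 2 / β * ∑' n, T₂ n + 2 / β * ∑' n, T₃ n := by ring
      _ ≤ _ := by linarith
  refine hmain.trans ?_
  -- `(1/m₀) ≤ 2/M` and the constant
  have hp1 : (1 / m₀) ^ (k + 1) ≤ (2 * (1 / M)) ^ (k + 1) := pow_le_pow_left₀ (by positivity) hmM _
  have hp2 : (1 / m₀) ^ k * (1 / m₀) ≤ (2 * (1 / M)) ^ k * (2 * (1 / M)) :=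
    mul_le_mul (pow_le_pow_left₀ (by positivity) hmM _) hmM (by positivity) (by positivity)
  have hconst := headline_const_le k hX0
  have hMk : (0 : ℝ) < (1 / M) ^ (k + 1) := by positivity
  calc (k ! : ℝ) * (1 / m₀) ^ (k + 1) * (1 / 2) + (k + 1)! * (1 / m₀) ^ k * 2 * (1 / (2 * m₀)) + k * (k ! * X * 2 ^ (2 * k + 2) / (Λ * M ^ (k + 1))) * Λ
      = (k ! : ℝ) / 2 * (1 / m₀) ^ (k + 1) + (k + 1)! * ((1 / m₀) ^ k * (1 / m₀)) + k * k ! * X * 2 ^ (2 * k + 2) * (1 / M) ^ (k + 1) := by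
        have hMne : M ≠ 0 := hM.ne'
        have hΛne : Λ ≠ 0 := hΛ.ne'
        have hm₀ne : m₀ ≠ 0 := hm₀.ne'
        have e3 : (k : ℝ) * (k ! * X * 2 ^ (2 * k + 2) / (Λ * M ^ (k + 1))) * Λ = k * k ! * X * 2 ^ (2 * k + 2) * (1 / M) ^ (k + 1) := by
          rw [one_div_pow]; field_simp
        have e2 : ((k + 1)! : ℝ) * (1 / m₀) ^ k * 2 * (1 / (2 * m₀)) = (k + 1)! * ((1 / m₀) ^ k * (1 / m₀)) := by
          field_simp
        rw [e3, e2]; ring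
    _ ≤ (k ! : ℝ) / 2 * (2 * (1 / M)) ^ (k + 1) + (k + 1)! * ((2 * (1 / M)) ^ k * (2 * (1 / M))) + k * k ! * X * 2 ^ (2 * k + 2) * (1 / M) ^ (k + 1) := by
        gcongr
    _ = ((k ! : ℝ) * 2 ^ k + (k + 1)! * 2 ^ (k + 1) + k * k ! * X * 2 ^ (2 * k + 2)) * (1 / M) ^ (k + 1) := by
        rw [mul_pow, mul_pow, pow_succ (2 : ℝ) k]; ring
    _ ≤ ((k + 1)! * 2 ^ (2 * k + 2) * (1 + X)) * (1 / M) ^ (k + 1) := mul_le_mul_of_nonneg_right hconst hMk.le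
    _ = (k + 1)! * 2 ^ (2 * k + 2) * (1 + X) * (1 / M) ^ (k + 1) := by ring

/-- **Any floor up to `K·Λ`** (the law-row shape `W·max(m,|u|)^{−(k+1)}`): for `0 < m ≤ K·Λ`, `1 ≤ K`,
`|∂ᵤᵏ P(e,u)| ≤ (k+1)!·2^{2k+2}·(1+X)·K^{k+1}·max(m,|u|)^{−(k+1)}`; the order-`≤ 2` rows' dependence on `K = hi/Λ` is exactly this conversion.
[cite: BenfattoGiulianiMastropietro2006, §2.4 (2.36)] -/
theorem abs_iteratedDeriv_ppTrueKernel_le_of_floor {β Λ : ℝ} (hβ : 0 < β) (hΛ : 0 < Λ) {k : ℕ} {X : ℝ}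
    (hX : ∀ l ≤ k, ∀ x : ℝ, ‖iteratedFDeriv ℝ l salmhoferCutoff x‖ ≤ X) {m K : ℝ} (hm : 0 < m) (hK : 1 ≤ K) (hmK : m ≤ K * Λ) (e u : ℝ) :
    |iteratedDeriv k (fun v : ℝ => ppTrueKernel β Λ e v) u| ≤
      (k + 1)! * 2 ^ (2 * k + 2) * (1 + X) * K ^ (k + 1) * (1 / max m |u|) ^ (k + 1) := by
  have hX0 : 0 ≤ X := zero_le_one.trans (one_le_of_cutoff_jets hX)
  refine (abs_iteratedDeriv_ppTrueKernel_le hβ hΛ hX e u).trans ?_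
  have hM : 0 < max Λ |u| := lt_max_of_lt_left hΛ
  have hm' : 0 < max m |u| := lt_max_of_lt_left hm
  have hle : 1 / max Λ |u| ≤ K * (1 / max m |u|) := by
    rw [mul_one_div, div_le_div_iff₀ hM hm', one_mul]
    refine max_le (hmK.trans ?_) ?_
    · exact mul_le_mul_of_nonneg_left (le_max_left _ _) (zero_le_one.trans hK)
    · calc |u| = 1 * |u| := (one_mul _).symm
        _ ≤ K * max Λ |u| := mul_le_mul hK (le_max_right _ _) (abs_nonneg u) (zero_le_one.trans hK)
  calc ((k + 1)! : ℝ) * 2 ^ (2 * k + 2) * (1 + X) * (1 / max Λ |u|) ^ (k + 1)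
      ≤ (k + 1)! * 2 ^ (2 * k + 2) * (1 + X) * (K * (1 / max m |u|)) ^ (k + 1) := by gcongr
    _ = (k + 1)! * 2 ^ (2 * k + 2) * (1 + X) * K ^ (k + 1) * (1 / max m |u|) ^ (k + 1) := by rw [mul_pow]; ring

/-- **The loop-level jets by symmetry** (`P(e,u) = P(u,e)`): `|∂ₑᵏ P(e,u)| ≤ (k+1)!·2^{2k+2}·(1+X)·max(Λ,|e|)^{−(k+1)}` for all `e, u`.
[cite: BenfattoGiulianiMastropietro2006, §2.4 (2.36)] -/
theorem abs_iteratedDeriv_ppTrueKernel_e_le {β Λ : ℝ} (hβ : 0 < β) (hΛ : 0 < Λ) {k : ℕ} {X : ℝ}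
    (hX : ∀ l ≤ k, ∀ x : ℝ, ‖iteratedFDeriv ℝ l salmhoferCutoff x‖ ≤ X) (e u : ℝ) :
    |iteratedDeriv k (fun v : ℝ => ppTrueKernel β Λ v u) e| ≤ (k + 1)! * 2 ^ (2 * k + 2) * (1 + X) * (1 / max Λ |e|) ^ (k + 1) := by
  have hfun : (fun v : ℝ => ppTrueKernel β Λ v u) = fun v : ℝ => ppTrueKernel β Λ u v := funext fun v => ppTrueKernel_symm β Λ v u
  rw [hfun]
  exact abs_iteratedDeriv_ppTrueKernel_le hβ hΛ hX u e

/-- **`u ↦ ∂ᵤᵏP(e,u)` is continuous** (indeed `C^∞`: `contDiff_ppTrueKernel_u`), so the envelope transports to measurability / integration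
in the laws without further work. [cite: BenfattoGiulianiMastropietro2006, §2.1 (2.3)-(2.4)] -/
theorem continuous_iteratedDeriv_ppTrueKernel_u {β Λ : ℝ} (hβ : 0 < β) (hΛ : 0 < Λ) (e : ℝ) (k : ℕ) :
    Continuous (iteratedDeriv k (fun v : ℝ => ppTrueKernel β Λ e v)) :=
  (contDiff_ppTrueKernel_u hβ hΛ e (N := ⊤)).continuous_iteratedDeriv k (by exact_mod_cast le_top)

end Summit.HubbardSuperconductivity.HubbardSuperconductivity.Theorems.C4a

end
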